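import Summits.Ventures.PercRepro.ProfileUnicyclicCircuit
import Summits.Ventures.PercRepro.ProfileMixedStep

/-!
# PercRepro — THE PARALLEL-PAIR INSTANCE OF THE CIRCUIT-MARKED CONJECTURE IS THE `e`-MARKED THEOREM A (p10, gen 10;
`proofs/P10-AVFULL.md` §19(d))

For a PARALLEL PAIR `{e, e'}` (`M.closure {e} = M.closure {e'}`, both non-loops, `e ≠ e'`) the unicyclic sets with
circuit `{e, e'}` and independent complement are exactly the sets `insert e' X` with `X ∋ e` bi-independent in
`T := M ∖ e'` (`uniIndepSetsCirc_parallel_eq`): `U^{{e,e'}}_{k+1} = P^e_k(T)`, the `e`-MARKED bi-independent profile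
`markedBiIndepSets T e k := {X ∈ biIndepSets T k | e ∈ X}`.  So the instance `D = {e, e'}` of `UniCircLym` is exactly

  `(E)  (n_T − j)·P^e_j(T) ≤ (j + 1)·P^e_{j+1}(T)   for 2j + 3 ≤ n_T`  (`markedLym_iff_uniCircLym_parallel`),

the `e`-marked Theorem A (the density `P^e_j / C(n_T, j)` nondecreasing for `j + 1 ≤ n_T / 2`) — DATA: true on every
`(T, e)` with `n_T ≤ 9` and on random matroids with `10 … 13` elements; NOT proved; nothing here asserts it.

* `rk_insert_eq_of_mem_closure`, `rk_insert_eq_add_one_of_notMem_closure` (Finset rank of an insertion; `indep_of_rk_eq_card` and `rk_le_card'` are the tree's);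
* `markedBiIndepSets`, `mem_markedBiIndepSets`;
* `uniIndepSetsCirc_parallel_eq`, `card_uniIndepSetsCirc_parallel` (the transport);
* **`markedLym_iff_uniCircLym_parallel`** (the parallel-pair instance of the conjecture IS `(E)` for `(M ∖ e', e)`).
-/

open scoped Matroid

namespace PercRepro.Cogirth

open Finset ThmH Skew Shadow Profile

variable {α : Type} [DecidableEq α] {M : Matroid α} [M.Finite] {e e' : α}

/-- Inserting an element of the closure does not change the rank. -/
theorem rk_insert_eq_of_mem_closure {x : α} {Y : Finset α} (hY : Y ⊆ gr M) (hx : x ∈ M.closure (Y : Set α)) :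
    rk M (insert x Y) = rk M Y := by
  have hYE : (Y : Set α) ⊆ M.E := by rw [← coe_gr]; exact_mod_cast hY
  have hcoe : ((insert x Y : Finset α) : Set α) = insert x (Y : Set α) := Finset.coe_insert x Y
  apply le_antisymm
  · have h1 : M.eRk ((insert x Y : Finset α) : Set α) ≤ M.eRk (M.closure (Y : Set α)) := by
      apply M.eRk_mono
      rw [hcoe]
      exact Set.insert_subset hx (M.subset_closure _ hYE)
    rw [Matroid.eRk_closure_eq, ← coe_rk, ← coe_rk] at h1
    exact_mod_cast h1
  · have h1 : M.eRk (Y : Set α) ≤ M.eRk ((insert x Y : Finset α) : Set α) := by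
      apply M.eRk_mono
      rw [hcoe]
      exact Set.subset_insert _ _
    rw [← coe_rk, ← coe_rk] at h1
    exact_mod_cast h1

/-- Inserting an element of the ground set outside the closure raises the rank by one. -/
theorem rk_insert_eq_add_one_of_notMem_closure {x : α} {Y : Finset α} (hxE : x ∈ gr M)
    (hx : x ∉ M.closure (Y : Set α)) : rk M (insert x Y) = rk M Y + 1 := by
  have hxE' : x ∈ M.E := by rw [← coe_gr]; exact_mod_cast hxE
  have h := Matroid.eRk_insert_eq_add_one (M := M) (X := (Y : Set α)) ⟨hxE', hx⟩
  rw [← Finset.coe_insert, ← coe_rk, ← coe_rk] at h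
  exact_mod_cast h

/-- The `e`-marked bi-independent `k`-sets: bi-independent sets containing `e`. -/
noncomputable def markedBiIndepSets (M : Matroid α) [M.Finite] (e : α) (k : ℕ) : Finset (Finset α) :=
  (biIndepSets M k).filter (fun X => e ∈ X)

/-- Membership in `markedBiIndepSets`. -/
theorem mem_markedBiIndepSets {k : ℕ} {X : Finset α} :
    X ∈ markedBiIndepSets M e k ↔ X ∈ biIndepSets M k ∧ e ∈ X := by
  unfold markedBiIndepSets
  rw [mem_filter]

/-- **The transport**: for a parallel pair `{e, e'}`, the unicyclic `(k+1)`-sets with circuit `{e, e'}` and independent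
complement are the sets `insert e' X` with `X ∋ e` bi-independent in `M ∖ e'` of size `k`. -/
theorem uniIndepSetsCirc_parallel_eq (he : e ∈ gr M) (he' : e' ∈ gr M) (hne : e ≠ e')
    (hcl : M.closure {e} = M.closure {e'}) (k : ℕ) :
    uniIndepSetsCirc M {e, e'} (k + 1) =
      (markedBiIndepSets (M ＼ ({e'} : Set α)) e k).image (fun X => insert e' X) := by
  have heE : e ∈ M.E := by rw [← coe_gr]; exact_mod_cast he
  have he'E : e' ∈ M.E := by rw [← coe_gr]; exact_mod_cast he'
  -- e' ∈ closure of any set containing e, and conversely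
  have he'cl : ∀ Y : Finset α, Y ⊆ gr M → e ∈ Y → e' ∈ M.closure (Y : Set α) := by
    intro Y hY heY
    have h1 : e' ∈ M.closure ({e} : Set α) := by rw [hcl]; exact M.mem_closure_self e' he'E
    exact M.closure_subset_closure (Set.singleton_subset_iff.2 (Finset.mem_coe.2 heY)) h1
  have hecl : ∀ Z : Set α, e' ∈ M.closure Z → e ∈ M.closure Z := by
    intro Z h
    have h1 : e ∈ M.closure ({e'} : Set α) := by rw [← hcl]; exact M.mem_closure_self e heE
    have h2 : M.closure ({e'} : Set α) ⊆ M.closure (M.closure Z) :=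
      M.closure_subset_closure (Set.singleton_subset_iff.2 h)
    rw [Matroid.closure_closure] at h2
    exact h2 h1
  ext X
  rw [mem_uniIndepSetsCirc, mem_uniIndepSets, Finset.mem_image]
  constructor
  · rintro ⟨⟨hXg, hXk, _, hXc⟩, hcirc⟩
    have he'C : e' ∈ circ M X := by rw [hcirc]; exact Finset.mem_insert_of_mem (Finset.mem_singleton_self e')
    have heC : e ∈ circ M X := by rw [hcirc]; exact Finset.mem_insert_self e _
    have he'X : e' ∈ X := circ_subset X he'C
    have heX : e ∈ X := circ_subset X heC
    rw [mem_circ] at he'C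
    refine ⟨X.erase e', ?_, Finset.insert_erase he'X⟩
    rw [mem_markedBiIndepSets, mem_biIndepSets, gr_delete']
    have hsub : X.erase e' ⊆ (gr M).erase e' := Finset.erase_subset_erase e' hXg
    have hcompl : (gr M).erase e' \ X.erase e' = gr M \ X := by
      ext x
      simp only [Finset.mem_sdiff, Finset.mem_erase]
      constructor
      · rintro ⟨⟨hxe, hxg⟩, hx⟩
        exact ⟨hxg, fun hxX => hx ⟨hxe, hxX⟩⟩
      · rintro ⟨hxg, hxX⟩
        exact ⟨⟨fun hxe => hxX (hxe ▸ he'X), hxg⟩, fun h => hxX h.2⟩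
    have hsubc : gr M \ X ⊆ (gr M).erase e' := by
      intro x hx
      rw [Finset.mem_sdiff] at hx
      rw [Finset.mem_erase]
      exact ⟨fun hxe => hx.2 (hxe ▸ he'X), hx.1⟩
    refine ⟨⟨hsub, ?_, ?_, ?_⟩, Finset.mem_erase.2 ⟨hne, heX⟩⟩
    · rw [Finset.card_erase_of_mem he'X, hXk]; rfl
    · rw [rk_delete hsub]; exact he'C.2
    · rw [hcompl, rk_delete hsubc]; exact hXc
  · rintro ⟨Y, hY, rfl⟩
    rw [mem_markedBiIndepSets, mem_biIndepSets, gr_delete'] at hY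
    obtain ⟨⟨hYg, hYk, hYr, hYc⟩, heY⟩ := hY
    have he'Y : e' ∉ Y := fun h => (Finset.mem_erase.1 (hYg h)).1 rfl
    have hYg' : Y ⊆ gr M := hYg.trans (Finset.erase_subset e' _)
    have hcompl : (gr M).erase e' \ Y = gr M \ insert e' Y := by
      ext x
      simp only [Finset.mem_sdiff, Finset.mem_erase, Finset.mem_insert]
      constructor
      · rintro ⟨⟨hxe, hxg⟩, hxY⟩
        exact ⟨hxg, fun h => h.elim hxe hxY⟩
      · rintro ⟨hxg, hx⟩
        exact ⟨⟨fun h => hx (Or.inl h), hxg⟩, fun h => hx (Or.inr h)⟩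
    have hsubc : gr M \ insert e' Y ⊆ (gr M).erase e' := by
      intro x hx
      rw [Finset.mem_sdiff, Finset.mem_insert] at hx
      rw [Finset.mem_erase]
      exact ⟨fun h => hx.2 (Or.inl h), hx.1⟩
    have hrkY : rk M Y = Y.card := by rw [← rk_delete hYg]; exact hYr
    have hrk : rk M (insert e' Y) = Y.card := by
      rw [rk_insert_eq_of_mem_closure hYg' (he'cl Y hYg' heY)]; exact hrkY
    have hcard : (insert e' Y).card = k + 1 := by rw [Finset.card_insert_of_notMem he'Y, hYk]
    have hYind : M.Indep (Y : Set α) := indep_of_rk_eq_card hrkY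
    refine ⟨⟨Finset.insert_subset he' hYg', hcard, by rw [hrk, hcard, hYk], ?_⟩, ?_⟩
    · rw [← rk_delete hsubc, ← hcompl]; exact hYc
    · -- the circuit-carrier of `insert e' Y` is `{e, e'}`
      ext x
      rw [mem_circ]
      simp only [Finset.mem_insert, Finset.mem_singleton]
      constructor
      · rintro ⟨hx, hxr⟩
        by_contra hxne
        have hxe : x ≠ e := fun h => hxne (Or.inl h)
        have hxe' : x ≠ e' := fun h => hxne (Or.inr h)
        have hxY : x ∈ Y := hx.resolve_left hxe'
        have h1 : (insert e' Y).erase x = insert e' (Y.erase x) := Finset.erase_insert_of_ne (Ne.symm hxe')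
        have h2 : e' ∉ Y.erase x := fun h => he'Y (Finset.mem_of_mem_erase h)
        have heYx : e ∈ Y.erase x := Finset.mem_erase.2 ⟨Ne.symm hxe, heY⟩
        have hsubYx : Y.erase x ⊆ gr M := (Finset.erase_subset x Y).trans hYg'
        rw [h1, rk_insert_eq_of_mem_closure hsubYx (he'cl _ hsubYx heYx),
          Finset.card_insert_of_notMem h2] at hxr
        have := rk_le_card' (M := M) (Y.erase x)
        omega
      · intro hx
        rcases hx with hx | hx
        · -- x = e: `(insert e' Y).erase e = insert e' (Y.erase e)` is independent
          rw [hx]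
          refine ⟨Or.inr heY, ?_⟩
          have h1 : (insert e' Y).erase e = insert e' (Y.erase e) := Finset.erase_insert_of_ne (Ne.symm hne)
          have h2 : e' ∉ Y.erase e := fun h => he'Y (Finset.mem_of_mem_erase h)
          have hsubYe : Y.erase e ⊆ gr M := (Finset.erase_subset e Y).trans hYg'
          have hnot : e ∉ M.closure ((Y.erase e : Finset α) : Set α) := by
            rw [Finset.coe_erase]
            exact hYind.notMem_closure_sdiff_of_mem (Finset.mem_coe.2 heY)
          have hnot' : e' ∉ M.closure ((Y.erase e : Finset α) : Set α) := fun h => hnot (hecl _ h)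
          rw [h1, rk_insert_eq_add_one_of_notMem_closure he' hnot', Finset.card_insert_of_notMem h2]
          congr 1
          rw [← rk_delete ((Finset.erase_subset e Y).trans hYg)]
          -- rk (M ∖ e') (Y.erase e) = #(Y.erase e): a subset of an independent set
          have hYe : M.Indep ((Y.erase e : Finset α) : Set α) := hYind.subset (by
            rw [Finset.coe_erase]; exact Set.sdiff_subset)
          have := hYe.eRk_eq_encard
          rw [← coe_rk, Set.encard_coe_eq_coe_finsetCard] at this
          rw [rk_delete ((Finset.erase_subset e Y).trans hYg)]
          exact_mod_cast this
        · -- x = e': `(insert e' Y).erase e' = Y` is independent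
          rw [hx]
          refine ⟨Or.inl rfl, ?_⟩
          rw [Finset.erase_insert he'Y]
          exact hrkY

/-- The transport of counts: `U^{{e,e'}}_{k+1} = P^e_k(M ∖ e')` for a parallel pair `{e, e'}`. -/
theorem card_uniIndepSetsCirc_parallel (he : e ∈ gr M) (he' : e' ∈ gr M) (hne : e ≠ e')
    (hcl : M.closure {e} = M.closure {e'}) (k : ℕ) :
    (uniIndepSetsCirc M {e, e'} (k + 1)).card = (markedBiIndepSets (M ＼ ({e'} : Set α)) e k).card := by
  rw [uniIndepSetsCirc_parallel_eq he he' hne hcl k]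
  apply Finset.card_image_of_injOn
  intro Y₁ hY₁ Y₂ hY₂ h
  rw [Finset.mem_coe, mem_markedBiIndepSets, mem_biIndepSets, gr_delete'] at hY₁ hY₂
  have h₁ : e' ∉ Y₁ := fun hh => (Finset.mem_erase.1 (hY₁.1.1 hh)).1 rfl
  have h₂ : e' ∉ Y₂ := fun hh => (Finset.mem_erase.1 (hY₂.1.1 hh)).1 rfl
  have := congrArg (fun Z : Finset α => Z.erase e') h
  simpa only [Finset.erase_insert h₁, Finset.erase_insert h₂] using this

/-- **THE PARALLEL-PAIR INSTANCE OF `UniCircLym` IS THE `e`-MARKED THEOREM A**: with `T = M ∖ e'`, the instance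
`D = {e, e'}`, `k = j + 1` of the conjecture is `(n_T − j)·P^e_j(T) ≤ (j + 1)·P^e_{j+1}(T)`. -/
theorem markedLym_iff_uniCircLym_parallel (he : e ∈ gr M) (he' : e' ∈ gr M) (hne : e ≠ e')
    (hcl : M.closure {e} = M.closure {e'}) (j : ℕ) :
    (((gr M).card - (j + 1)) * (uniIndepSetsCirc M {e, e'} (j + 1)).card ≤
        (j + 1) * (uniIndepSetsCirc M {e, e'} (j + 2)).card) ↔
      (((gr (M ＼ ({e'} : Set α))).card - j) * (markedBiIndepSets (M ＼ ({e'} : Set α)) e j).card ≤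
        (j + 1) * (markedBiIndepSets (M ＼ ({e'} : Set α)) e (j + 1)).card) := by
  rw [card_uniIndepSetsCirc_parallel he he' hne hcl j, card_uniIndepSetsCirc_parallel he he' hne hcl (j + 1),
    gr_delete', Finset.card_erase_of_mem he']
  have e1 : (gr M).card - (j + 1) = (gr M).card - 1 - j := by omega
  rw [e1]

end PercRepro.Cogirth
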